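import Literature.MathematicalPhysics.QuantumFieldTheory.Balaban1983to89.B7Ineq139General
import Literature.MathematicalPhysics.QuantumFieldTheory.Balaban1983to89.B7Ineq148General
import Literature.MathematicalPhysics.QuantumFieldTheory.Balaban1983to89.B7Prop5GeneralInduction

/-!
# `Balaban1983to89.B7Prop5GeneralLevels` — T. Bałaban, *Averaging operations for lattice gauge theories*, Commun. Math. Phys.
**98** (1985) 17–51 [Balaban1985Averaging]: Proposition 5 at a general regular background `U₀` — file 1/2: the LOCALITY of
the covariant one-step objects (58)/(82)/(65)/(89)/(121)–(122) and the ONE-STEP INPUTS (139), (148), (131), linearity,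
locality DISCHARGED at every level background `Ū₀ʲ = avgIter L U₀ j` from Literature kernels (file 2 = `B7Prop5General`)

statement-level skeleton of published theorems with citation tags; proofs where landed; nothing here is a claim about the Yang–Mills mass gap

v1.1 (p06 gen 20, 2026-08-23): DOCFIX ONLY — one cite locator «Prop. 1 (51) p.25» → «p.26» (docstring of `level_loops`): printed
p. 25 [PDF 9] ends with (50), Proposition 1 with (51) stands on p. 26 [PDF 10] (text layer `p0010.txt` L1–L5, running head «26 T.
Bałaban»; r04 `CITELOC-AUDIT-g22.md` §1–§2, r12 `CITELOC-SWEEP-g14.md` §8); declarations byte-identical.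

PDF held: `paper:balaban1985-cmp98-averaging` (journal page = PDF page + 16); pp. 39–42 [PDF 23–26] ((137)–(157), Prop. 5),
p. 36 [PDF 20] (Prop. 3), p. 31 [PDF 15] (locality after (91)), p. 24 [PDF 8] (locality after (43)) read from the materialised
text layer `~/.lit/texts/paper-balaban1985-cmp98-averaging/p0023.txt`–`p0026.txt` and the renders of `b2b-balaban-ref1/pages/`.

CITATION HEADER / WHAT IS REPRODUCED.  SKELETON rows **B7.Prop5** («Prop. 5, (156)–(157)»), **B7.Eq149** («(149)–(155)»),
**B7.Eq139** («(139), (142)–(147)») — cell `lit-balaban`, HOME `run/shared/lean/pub/lit-balaban/`, seat p06 gen 3 = unit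
`lit-balaban-p06`; owner r04 (ACK 2026-08-21T04:30:51Z), referee ref-4.  Before this file (ROWS-B7 v3.3) the inductions
(143)–(147), (149)–(155) were PROVED at a general background PER BOND (`B7Prop5GeneralLinear.ineq143/ineq147`,
`B7Prop5GeneralInduction.ineq149/prop5_157/prop5_156`) FROM the displayed one-step inputs at the level backgrounds `Ū₀ʲ`,
`j < k`, as HYPOTHESES: `h139` (the majorant (139)), `hadd`/`hsmul` (linearity of `L(Q(V)·)_c`), `hloc` (locality of `C(V,
·)(c)`), `h148`/`hdiff` ((148), differentiability on the box variables `𝔸^{S1}`).  THIS FILE supplies each of them: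
`h139_levels` ← `B7Ineq139General.ineq139_general_of_pdev` (p06 gen 3, (139) @gen); `hadd_levels`/`hsmul_levels` ←
`B7Prop3GeneralTild.linQcov_add/_smul`; `hloc_levels` ← §1 = the printed locality at a general background, p. 31 verbatim:
*"these operations have the same locality properties as the averages Ū^k"* with p. 24 *"depends only on the bond variables U_b
for b ⊂ B^k(c₋) ∪ B^k(c₊)"* (`B7Prop5Flat.dbavg_congr/oneC_congr` = the case `V₀ = 1`); `h148_levels`/`hdiff_levels` ←
`B7Ineq148General.ineq148_general` / `differentiableOn_Ccov_insCfg` (p06 gen 2, p247534); the level regularity ←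
`B7Eq123General.level_data` + `blockLoops_of_pdev` (Prop. 2 at every level, p. 37: *"the sequence U₀, Ū₀, …, Ū₀^k
satisfies the assumptions of Proposition 2"*; Prop. 1's loop mechanism).

DICTIONARY (as in `B7Prop5GeneralInduction`; `B = ηA`, every level rescaled to `ℤᵈ`, `s_j = (Lʲη)² = (Lʲ/Lᵏ)²`): print's
`2C′₁α₀` (post-(144) convention `C′₁ ↔ L²C′₁`) ↦ `thetaGen d L α₀ = 3200(d+1)(d+4)L^{d+1}α₀` (= `B7Ineq139General`'s
`1600(d+1)(d+4)L^{d+2}β` at `β = 2α₀s_j`, per level factor `s_j·L`); `C″₁` of (148) ↦ `C1ppGen d L = 4·131072(d+1)²·L^{d+2}`;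
`C₃` ↦ `C3Gen d L = 16·C1ppGen d L` («C₃ > C″₁»); the background regularity (52) ↦ `pdev U₀ < α₀L^{−2k}` for a `G`-valued `U₀`,
`G` an `AvgClosed` structure group (unitaries), `C₀α₀ ≤ 1/3`, `4α₀ ≤ c₂′(d, L)` (Prop. 2's regime, `B7Prop2Explicit`).

WHAT THIS FILE PROVES (kernel, 0 sorry, standard axioms): §1 LOCALITY at a general background — `tHol_treeWord_congr` (58),
`Fcov_congr`/`wframe_congr` (82), `tild_congr` (65), **`dbavgCov_congr`** (89), `Qcov_congr`/`linQcov_congr`/**`Ccov_congr`**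
(121)–(122): two pairs `(V₀, A)`, `(V₀′, A′)` agreeing on the bonds of `[q, q + (L−1)𝟙 + Le_κ] = B(c₋) ∪ B(c₊)` give the same
value at `c = ⟨q, q + Le_κ⟩`; §2 the constants `thetaGen`, `C1ppGen`, `C3Gen` and THE LEVEL DISCHARGES at `Ū₀ʲ`, `j ≤ k` resp.
`j < k`: `level_loops` (block loops `≤ 16(d+1)(d+4)L²·2α₀s_j ≤ 1/64`), `hadd_levels`, `hsmul_levels`, **`h139_levels`**
(`‖L(Q(Ū₀ʲ)G)_c‖ ≤ avQ L |G| (c) + θ·s_j·L·ddQ L |G| (c)` — print's (144) «≦ Q|·| + C′₁2α₀(Lʲη)²Q″|·|»), `hloc_levels`,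
`h148_levels` (radius `c₃/2`, `C″₁ = C1ppGen`), `hdiff_levels` — LITERALLY the binders of `B7Prop5GeneralLinear` §3 /
`B7Prop5GeneralInduction` §Levels.  File 2 (`B7Prop5General`) feeds them in: (147)/(157)/(156) @gen unconditional.
DIVERGENCES from print: constants are admissible witnesses, not optimal; radius of (148) `c₃/2`; `ℤᵈ`, corner blocks,
`U1`/`AvgClosed` background as in the lineage.  RELATION TO THE SUBSTRATE / NEAR-DUPLICATES (gate notice, intended):
`Summits/…/Support/ShellMeasureAverageLocality148` (`tHol_treeWord_congr`, `Fcov_congr`, `wframe_congr`, `tild_congr`,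
`dbavgCov_congr`, `Qcov_congr`, `linQcov_congr`, `Ccov_congr`) and `…/ShellMeasureAverageProp5Levels` (`hadd_levels`,
`hsmul_levels`, `hloc_levels`) prove the same statements Summits-side for the substrate cell; a Literature file CANNOT import
them (`import.summits-from-literature`), and the lit-balaban placement rule (human 2026-08-19: Literature holds the published
statement AND our formalisation of its published proof) puts the proof of the printed Prop. 5 here — so these are re-proved, not
re-used; the policy-conformant de-duplication is the opposite direction (the substrate files importing this module), which is
the substrate owner's call (INTERFACES IF2-27: R5 pairing, no MOVE asked).  The constants `thetaGen`/`C1ppGen`/`C3Gen` are this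
file's own names.
-/

noncomputable section

open scoped BigOperators
open NormedSpace Finset Metric

namespace Literature.MathematicalPhysics.QuantumFieldTheory.Balaban1983to89.B7Prop5GeneralLevels

open B7Prop1Explicit B7Prop1Local B7Prop2Explicit B7Prop3Flat B7Prop4Flat B7Eq92Concrete B7Prop3GeneralLinear
  B7Prop4GeneralLevels B7Ineq148 B7Prop5GeneralOperators B7Prop5GeneralOperatorFacts B7Prop5GeneralLinear
  B7Prop5GeneralInduction B7Ineq139General
open B7Prop5Flat (BondIn S1 bump bondsIn mem_bondsIn restr agreeOn_expCfg)
open B7Prop3GeneralTild (linQcov_add linQcov_smul)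
open B7Eq123General (blockLoops_of_pdev level_data prop4_general)
open B7Ineq148General (ineq148_general differentiableOn_Ccov_insCfg)
open MatrixLog (mlog)

-- `Site` alone would resolve to the torus sites of `Setup.lean`; re-export the `ℤ^d` sites of `B7Prop1Explicit`.
export B7Prop1Explicit (Site)

variable {d : ℕ}

/-! ## §1 Locality of the covariant one-step objects (58), (82), (65), (89), (121)–(122) -/

section Group

variable {G : Type*}

/-- Agreement of a configuration with itself (the box-agreement relation `AgreeOn` of `B7Prop1Local`). [folklore] -/
private theorem agreeOn_rfl {lo hi : Site d} {V : Site d → Fin d → G} : AgreeOn lo hi V V := fun _ _ _ _ => rfl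

variable [Group G]

/-- Agreement on the bonds of a box is inherited by pointwise products (`V₁V₀`). [folklore] -/
private theorem agreeOn_mul {lo hi : Site d} {V V' W W' : Site d → Fin d → G} (hV : AgreeOn lo hi V V')
    (hW : AgreeOn lo hi W W') : AgreeOn lo hi (V * W) (V' * W') := fun x κ hx hx' => by
  simp only [Pi.mul_apply, hV x κ hx hx', hW x κ hx hx']

/-- **LOCALITY OF THE TWISTED TRANSPORT (58)** `(R_{0,y}V₁)(Γ_{y,y+r}) = (V₁V₀)(Γ)·V₀(Γ)⁻¹` along the tree contour inside a
box containing `y`, `y + r`: it sees the PAIR `(V₀, V₁)` only through the bonds of the box. [cite: Balaban1985Averaging, (58) p.27, p.24 (after (43))] -/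
theorem tHol_treeWord_congr {lo hi : Site d} {V₀ V₀' V₁ V₁' : Site d → Fin d → G} (h₀ : AgreeOn lo hi V₀ V₀')
    (h₁ : AgreeOn lo hi V₁ V₁') (y r : Site d) (hy : InBox lo hi y) (hyr : InBox lo hi (y + r)) :
    tHol V₀ V₁ y (treeWord r) = tHol V₀' V₁' y (treeWord r) := by
  unfold tHol
  rw [hol_treeWord_congr (agreeOn_mul h₁ h₀) y r hy hyr, hol_treeWord_congr h₀ y r hy hyr]

end Group

section Covariant

variable {𝔸 : Type*} [NormedRing 𝔸] [NormedAlgebra ℂ 𝔸] [CompleteSpace 𝔸]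

omit [NormedRing 𝔸] [NormedAlgebra ℂ 𝔸] [CompleteSpace 𝔸] in
/-- Box arithmetic: the block `B(y) = y + [0, L)ᵈ` lies in `[lo, hi]` when `y` does and `y + (L−1)𝟙 ≤ hi`. [folklore] -/
private theorem inBox_add_boxVec {lo hi : Site d} {L : ℕ} {y : Site d} (hy : InBox lo hi y)
    (hyL : ∀ i, y i + ((L : ℤ) - 1) ≤ hi i) (r : Fin d → Fin L) : InBox lo hi (y + boxVec L r) := fun i => by
  have hr : 0 ≤ boxVec L r i ∧ boxVec L r i + 1 ≤ L :=
    ⟨by simp [boxVec], by have := (r i).isLt; simp only [boxVec]; omega⟩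
  have := hy i; have := hyL i
  simp only [Pi.add_apply]
  constructor <;> omega

omit [CompleteSpace 𝔸] in
/-- **LOCALITY OF THE FRAME EXPONENT (82)/(62)** `F(y) = Σ_{x∈B(y)} L^{−d} log (R_{0,y}V₁)(Γ_{y,x})` at a general background: it
depends on `(V₀, V₁)` only through the bonds of `B(y)`, hence of any box containing it. [cite: Balaban1985Averaging, (82) p.30, p.31 (after (91))] -/
theorem Fcov_congr (L : ℕ) {lo hi : Site d} {V₀ V₀' V₁ V₁' : Site d → Fin d → 𝔸ˣ} (h₀ : AgreeOn lo hi V₀ V₀')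
    (h₁ : AgreeOn lo hi V₁ V₁') (y : Site d) (hy : InBox lo hi y) (hyL : ∀ i, y i + ((L : ℤ) - 1) ≤ hi i) :
    Fcov L V₀ V₁ y = Fcov L V₀' V₁' y := by
  unfold Fcov
  refine Finset.sum_congr rfl fun r _ => ?_
  rw [tHol_treeWord_congr h₀ h₁ y (boxVec L r) hy (inBox_add_boxVec hy hyL r)]

/-- **LOCALITY OF THE BLOCK FRAME `\overline{R_{0,y}V₁} = exp F(y)` (82)** at a general background. [cite: Balaban1985Averaging, (82) p.30, p.31 (after (91))] -/
theorem wframe_congr (L : ℕ) {lo hi : Site d} {V₀ V₀' V₁ V₁' : Site d → Fin d → 𝔸ˣ} (h₀ : AgreeOn lo hi V₀ V₀')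
    (h₁ : AgreeOn lo hi V₁ V₁') (y : Site d) (hy : InBox lo hi y) (hyL : ∀ i, y i + ((L : ℤ) - 1) ≤ hi i) :
    wframe L V₀ V₁ y = wframe L V₀' V₁' y := by
  unfold wframe
  rw [Fcov_congr L h₀ h₁ y hy hyL]

/-- **LOCALITY OF `Ṽ₁(c) = (\overline{V₁V₀})_c(V̄₀)_c⁻¹` (65)**: the pair `(V₀, V₁)` enters only through the bonds of
`B(c₋) ∪ B(c₊)` (`B7Prop1Local.bavg_congr`, twice). [cite: Balaban1985Averaging, (65) p.29, p.24 (after (43))] -/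
theorem tild_congr (L : ℕ) (hL : 1 ≤ L) (q : Site d) (κ : Fin d) {V₀ V₀' V₁ V₁' : Site d → Fin d → 𝔸ˣ}
    (h₀ : AgreeOn q (bondHi L q κ) V₀ V₀') (h₁ : AgreeOn q (bondHi L q κ) V₁ V₁') :
    tild L V₀ V₁ q κ = tild L V₀' V₁' q κ := by
  rw [tild_apply, tild_apply, bavg_congr L hL q κ (agreeOn_mul h₁ h₀), bavg_congr L hL q κ h₀]

/-- **LOCALITY OF THE COVARIANT DOUBLE-BAR AVERAGE `V̿₁(c)` (89) AT A GENERAL BACKGROUND** — p. 31: (89)–(91) «have the same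
locality properties as the averages Ū^k» (p. 24: «depends only on the bond variables U_b for b ⊂ B(c₋) ∪ B(c₊)»): two PAIRS
`(V₀, V₁)`, `(V₀′, V₁′)` agreeing on the bonds of `[q, q + (L−1)𝟙 + Le_κ] = B(c₋) ∪ B(c₊)` have the same `V̿₁(c)`, `c = ⟨q, q + Le_κ⟩`
(`B7Prop5Flat.dbavg_congr` is the case `V₀ = V₀′ = 1`). [cite: Balaban1985Averaging, p.31 (after (91)), (89) p.31, p.24 (after (43))] -/
theorem dbavgCov_congr (L : ℕ) (hL : 1 ≤ L) (q : Site d) (κ : Fin d) {V₀ V₀' V₁ V₁' : Site d → Fin d → 𝔸ˣ}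
    (h₀ : AgreeOn q (bondHi L q κ) V₀ V₀') (h₁ : AgreeOn q (bondHi L q κ) V₁ V₁') :
    dbavgCov L V₀ V₁ q κ = dbavgCov L V₀' V₁' q κ := by
  have hq : InBox q (bondHi L q κ) q := fun i => by simp only [bondHi]; split_ifs <;> omega
  have hqL : InBox q (bondHi L q κ) (q + (L : ℤ) • e κ) := fun i => by
    simp only [bondHi, add_zsmul_e_apply]; split_ifs <;> omega
  have h1 : ∀ i, q i + ((L : ℤ) - 1) ≤ bondHi L q κ i := fun i => by simp only [bondHi]; split_ifs <;> omega
  have h2 : ∀ i, (q + (L : ℤ) • e κ) i + ((L : ℤ) - 1) ≤ bondHi L q κ i := fun i => by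
    simp only [bondHi, add_zsmul_e_apply]; split_ifs <;> omega
  rw [dbavgCov_apply, dbavgCov_apply, wframe_congr L h₀ h₁ q hq h1, wframe_congr L h₀ h₁ _ hqL h2,
    tild_congr L hL q κ h₀ h₁, bavg_congr L hL q κ h₀]

omit [CompleteSpace 𝔸] in
/-- Agreement on the bonds of a box is inherited by complex multiples (the ray `tA` of (122)). [folklore] -/
private theorem agreeOn_smul {lo hi : Site d} {A A' : Site d → Fin d → 𝔸} (h : AgreeOn lo hi A A') (t : ℂ) :
    AgreeOn lo hi (t • A) (t • A') := fun x κ hx hx' => by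
  simp only [Pi.smul_apply, h x κ hx hx']

/-- **LOCALITY OF `Q(V₀, A, c) = (1/i) log V̿₁(c)` (121)** in the pair (background, field). [cite: Balaban1985Averaging, (121) p.36, p.31 (after (91))] -/
theorem Qcov_congr (L : ℕ) (hL : 1 ≤ L) (q : Site d) (κ : Fin d) {V₀ V₀' : Site d → Fin d → 𝔸ˣ}
    {A A' : Site d → Fin d → 𝔸} (h₀ : AgreeOn q (bondHi L q κ) V₀ V₀') (hA : AgreeOn q (bondHi L q κ) A A') :
    Qcov L V₀ A q κ = Qcov L V₀' A' q κ := by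
  unfold Qcov
  rw [dbavgCov_congr L hL q κ h₀ (agreeOn_expCfg hA)]

/-- **LOCALITY OF THE LINEAR PART `L(Q(V₀)A)_c` (122)** (the `t`-derivative of `Q(V₀, tA, c)` at `0`). [cite: Balaban1985Averaging, (122) p.36, p.31 (after (91))] -/
theorem linQcov_congr (L : ℕ) (hL : 1 ≤ L) (q : Site d) (κ : Fin d) {V₀ V₀' : Site d → Fin d → 𝔸ˣ}
    {A A' : Site d → Fin d → 𝔸} (h₀ : AgreeOn q (bondHi L q κ) V₀ V₀') (hA : AgreeOn q (bondHi L q κ) A A') :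
    linQcov L V₀ A q κ = linQcov L V₀' A' q κ := by
  unfold linQcov
  have h : (fun t : ℂ => Qcov L V₀ (t • A) q κ) = fun t : ℂ => Qcov L V₀' (t • A') q κ :=
    funext fun t => Qcov_congr L hL q κ h₀ (agreeOn_smul hA t)
  rw [h]

/-- **LOCALITY OF THE ONE-STEP REMAINDER `C(V₀, A, c)` (122)** — the binder `hloc` of `B7Prop5GeneralInduction`: `C(V₀, ·, c)`
depends only on `A_b`, `b ⊂ B(c₋) ∪ B(c₊)` (and on `V₀` there). [cite: Balaban1985Averaging, (122) p.36, p.34, p.31 (after (91))] -/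
theorem Ccov_congr (L : ℕ) (hL : 1 ≤ L) (q : Site d) (κ : Fin d) {V₀ V₀' : Site d → Fin d → 𝔸ˣ}
    {A A' : Site d → Fin d → 𝔸} (h₀ : AgreeOn q (bondHi L q κ) V₀ V₀') (hA : AgreeOn q (bondHi L q κ) A A') :
    Ccov L V₀ A q κ = Ccov L V₀' A' q κ := by
  unfold Ccov
  rw [Qcov_congr L hL q κ h₀ hA, linQcov_congr L hL q κ h₀ hA]

end Covariant

/-! ## §2 The constants and the per-level discharges at the backgrounds `Ū₀ʲ = avgIter L U₀ j` -/

/-- print's `2C′₁α₀` (post-(144) convention `C′₁ ↔ L²C′₁`) for B7's own average: the coefficient of `(Lʲη)²·L·Q″` in (139)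
at the level background `Ū₀ʲ` is `θ·(Lʲη)²·L` with `θ = 3200(d+1)(d+4)L^{d+1}α₀` (`B7Ineq139General.ineq139_general_of_pdev`'s
`1600(d+1)(d+4)L^{d+2}β` at `β = 2α₀(Lʲη)²`). [cite: Balaban1985Averaging, (139) p.39, (143)–(144) pp.39–40] -/
def thetaGen (d L : ℕ) (α₀ : ℝ) : ℝ := 3200 * ((d : ℝ) + 1) * ((d : ℝ) + 4) * (L : ℝ) ^ (d + 1) * α₀

/-- print's `C″₁` of (148) for B7's own one-step remainder at a general background: `4·131072(d+1)²·L^{d+2}`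
(`B7Ineq148General.ineq148_general`). [cite: Balaban1985Averaging, (148) p.40] -/
def C1ppGen (d L : ℕ) : ℝ := 4 * (131072 * ((d : ℝ) + 1) ^ 2) * (L : ℝ) ^ (d + 2)

/-- print's `C₃` of (149)/(157) («C₃ > C″₁ … e.g. we may take C₃ = 6C″₁»; the per-bond bookkeeping takes `16C″₁`).
[cite: Balaban1985Averaging, (155) p.41, Prop. 5 p.42] -/
def C3Gen (d L : ℕ) : ℝ := 16 * C1ppGen d L

/-- `thetaGen ≥ 0` for `α₀ ≥ 0`. [folklore] -/
private theorem thetaGen_nonneg (d L : ℕ) {α₀ : ℝ} (hα : 0 ≤ α₀) : 0 ≤ thetaGen d L α₀ := by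
  unfold thetaGen; positivity

/-- `C1ppGen > 0` (`L ≥ 1`). [folklore] -/
private theorem C1ppGen_pos (d : ℕ) {L : ℕ} (hL : 1 ≤ L) : 0 < C1ppGen d L := by
  have : (0 : ℝ) < L := by exact_mod_cast hL
  unfold C1ppGen; positivity

/-- `C3Gen > 0` (`L ≥ 1`). [folklore] -/
private theorem C3Gen_pos (d : ℕ) {L : ℕ} (hL : 1 ≤ L) : 0 < C3Gen d L := by
  have := C1ppGen_pos d hL; unfold C3Gen; positivity

section Regime

variable {𝔸 : Type*} [NormedRing 𝔸] [NormedAlgebra ℂ 𝔸] [CompleteSpace 𝔸] [NormOneClass 𝔸]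

variable (L : ℕ) (hL : 2 ≤ L) {G : Subgroup 𝔸ˣ} (hG : AvgClosed d L G) (k : ℕ)
  (U₀ : Site d → Fin d → 𝔸ˣ) (hU₀ : ∀ x κ, U₀ x κ ∈ G) {α₀ : ℝ} (hα : 0 < α₀)
  (hα3 : C0 d * α₀ ≤ 1 / 3) (hα4 : 4 * α₀ ≤ c2' d L) (h52 : pdev U₀ < α₀ * (((L : ℝ) ^ k)⁻¹) ^ 2)

include hL hG hU₀ hα hα3 hα4 h52 in
/-- block loops of every level background `Ū₀ʲ`, `j ≤ k`, are within `1/64` of the unit at every `L`-bond (Prop. 2 at every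
level = `B7Eq123General.level_data`, then Prop. 1's mechanism `blockLoops_of_pdev`) — in particular `< 1`, the hypothesis of
`linQcov_add/_smul`. [cite: Balaban1985Averaging, Prop. 2 (53)–(54) p.26, p.37 (after (127)), Prop. 1 (51) p.26] -/
theorem level_loops (j : ℕ) (hj : j ≤ k) (q : Site d) (κ : Fin d) :
    (∀ r : Fin d → Fin L,
        ‖((Wcx L (avgIter L U₀ j) q κ (boxVec L r) : 𝔸ˣ) : 𝔸) - 1‖
          ≤ 16 * ((d : ℝ) + 1) * ((d : ℝ) + 4) * (L : ℝ) ^ 2 * (2 * (α₀ * ((L : ℝ) ^ j * ((L : ℝ) ^ k)⁻¹) ^ 2))) ∧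
      16 * ((d : ℝ) + 1) * ((d : ℝ) + 4) * (L : ℝ) ^ 2 * (2 * (α₀ * ((L : ℝ) ^ j * ((L : ℝ) ^ k)⁻¹) ^ 2)) ≤ 1 / 64 := by
  have hL1 : 1 ≤ L := le_trans (by norm_num) hL
  obtain ⟨hV, hβ0, hβ, hβmax⟩ := level_data L hL hG k U₀ hU₀ hα hα3 hα4 h52 j hj
  exact blockLoops_of_pdev hL1 hV hβ0 hβ hβmax q κ

include hL hG hU₀ hα hα3 hα4 h52 in
/-- … hence `< 1`. [folklore] -/
private theorem level_loops_lt_one (j : ℕ) (hj : j ≤ k) (q : Site d) (κ : Fin d) :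
    ∀ r : Fin d → Fin L, ‖((Wcx L (avgIter L U₀ j) q κ (boxVec L r) : 𝔸ˣ) : 𝔸) - 1‖ < 1 := by
  obtain ⟨hloop, hsmall⟩ := level_loops L hL hG k U₀ hU₀ hα hα3 hα4 h52 j hj q κ
  exact fun r => ((hloop r).trans hsmall).trans_lt (by norm_num)

include hL hG hU₀ hα hα3 hα4 h52 in
/-- **`hadd` at the levels**: the one-step linear part at `Ū₀ʲ` is additive (`B7Prop3GeneralTild.linQcov_add`). [cite: Balaban1985Averaging, (122) p.36, (124) p.36] -/
theorem hadd_levels : ∀ j < k, ∀ (F F' : Site d → Fin d → 𝔸) (z : Site d) (κ : Fin d),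
    linQcov L (avgIter L U₀ j) (F + F') ((L : ℤ) • z) κ =
      linQcov L (avgIter L U₀ j) F ((L : ℤ) • z) κ + linQcov L (avgIter L U₀ j) F' ((L : ℤ) • z) κ :=
  fun j hj F F' z κ =>
    linQcov_add L _ F F' ((L : ℤ) • z) κ (level_loops_lt_one L hL hG k U₀ hU₀ hα hα3 hα4 h52 j hj.le _ κ)

include hL hG hU₀ hα hα3 hα4 h52 in
/-- **`hsmul` at the levels**: the one-step linear part at `Ū₀ʲ` is `ℂ`-homogeneous (`B7Prop3GeneralTild.linQcov_smul`). [cite: Balaban1985Averaging, (122) p.36, (124) p.36] -/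
theorem hsmul_levels : ∀ j < k, ∀ (t : ℂ) (F : Site d → Fin d → 𝔸) (z : Site d) (κ : Fin d),
    linQcov L (avgIter L U₀ j) (t • F) ((L : ℤ) • z) κ = t • linQcov L (avgIter L U₀ j) F ((L : ℤ) • z) κ :=
  fun j hj t F z κ =>
    linQcov_smul L _ t F ((L : ℤ) • z) κ (level_loops_lt_one L hL hG k U₀ hU₀ hα hα3 hα4 h52 j hj.le _ κ)

include hL hG hU₀ hα hα3 hα4 h52 in
/-- **`h139` at the levels — (139) AT `Ū₀ʲ` (`B7Ineq139General.ineq139_general_of_pdev` with `β = 2α₀(Lʲ/Lᵏ)²`)**: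
`‖L(Q(Ū₀ʲ)G)_c‖ ≤ avQ L |G| (c) + θ·(Lʲ/Lᵏ)²·L·ddQ L |G| (c)`, `θ = thetaGen d L α₀` — print's (144) «|Q(Ū₀ʲ)·| ≦ Q|·| +
C′₁2α₀(Lʲη)²Q″|·|». [cite: Balaban1985Averaging, (139) p.39, (144) p.40] -/
theorem h139_levels : ∀ j < k, ∀ (G' : Site d → Fin d → 𝔸) (z : Site d) (κ : Fin d),
    ‖linQcov L (avgIter L U₀ j) G' ((L : ℤ) • z) κ‖ ≤
      avQ L (fun x κ' => ‖G' x κ'‖) ((L : ℤ) • z) κ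
        + thetaGen d L α₀ * ((L : ℝ) ^ j * ((L : ℝ) ^ k)⁻¹) ^ 2 * (L : ℝ) *
          ddQ L (fun x κ' => ‖G' x κ'‖) ((L : ℤ) • z) κ := by
  intro j hj G' z κ
  have hL1 : 1 ≤ L := le_trans (by norm_num) hL
  obtain ⟨hV, hβ0, hβ, hβmax⟩ := level_data L hL hG k U₀ hU₀ hα hα3 hα4 h52 j hj.le
  have h := ineq139_general_of_pdev L hV G' hL1 ((L : ℤ) • z) κ hβ0 hβ hβmax
  have hθ : 1600 * ((d : ℝ) + 1) * ((d : ℝ) + 4) * (L : ℝ) ^ (d + 2) * (2 * (α₀ * ((L : ℝ) ^ j * ((L : ℝ) ^ k)⁻¹) ^ 2))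
      = thetaGen d L α₀ * ((L : ℝ) ^ j * ((L : ℝ) ^ k)⁻¹) ^ 2 * (L : ℝ) := by
    rw [thetaGen, pow_succ]; ring
  rwa [hθ] at h

omit [NormOneClass 𝔸] in
include hL in
/-- **`hloc` at the levels** — LOCALITY of `C(Ū₀ʲ, ·)(c)` in the bonds of `B(c₋) ∪ B(c₊)` (§1 `Ccov_congr`). [cite: Balaban1985Averaging, p.34, p.31 (after (91))] -/
theorem hloc_levels : ∀ j < k, ∀ (F F' : Site d → Fin d → 𝔸) (z : Site d) (κ : Fin d),
    AgreeOn ((L : ℤ) • z) (bondHi L ((L : ℤ) • z) κ) F F' →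
      Ccov L (avgIter L U₀ j) F ((L : ℤ) • z) κ = Ccov L (avgIter L U₀ j) F' ((L : ℤ) • z) κ :=
  fun _ _ _ _ _ κ h => Ccov_congr L (le_trans (by norm_num) hL) _ κ agreeOn_rfl h

include hL hG hU₀ hα hα3 hα4 h52 in
/-- **`h148` at the levels** — (148) for `C(Ū₀ʲ, ·, c)` on the box variables `𝔸^{S1}` with radius `c₃/2` and `C″₁ = C1ppGen d L`
(`B7Ineq148General.ineq148_general`, p06 gen 2). [cite: Balaban1985Averaging, (148) p.40] -/
theorem h148_levels : ∀ j < k, ∀ (z : Site d) (κ : Fin d),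
    Ineq148Printed (fun a : ↥(S1 L ((L : ℤ) • z) κ) → 𝔸 =>
      Ccov L (avgIter L U₀ j) (insCfg (S1 L ((L : ℤ) • z) κ) a) ((L : ℤ) • z) κ) (L : ℝ) d (c3 d L / 2) (C1ppGen d L) := by
  intro j hj z κ
  have hL1 : 1 ≤ L := le_trans (by norm_num) hL
  obtain ⟨hV, -, -, -⟩ := level_data L hL hG k U₀ hU₀ hα hα3 hα4 h52 j hj.le
  obtain ⟨hreg, hα1⟩ := level_loops L hL hG k U₀ hU₀ hα hα3 hα4 h52 j hj.le ((L : ℤ) • z) κ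
  exact ineq148_general hL1 hV _ κ hα1 hreg _

include hL hG hU₀ hα hα3 hα4 h52 in
/-- **`hdiff` at the levels** — differentiability of `a ↦ C(Ū₀ʲ, ins a, c)` at the points `‖a‖ < c₃/2`
(`B7Ineq148General.differentiableOn_Ccov_insCfg` on the ball of radius `c₃`). [cite: Balaban1985Averaging, Prop. 3 p.36, (148) p.40] -/
theorem hdiff_levels : ∀ j < k, ∀ (z : Site d) (κ : Fin d) (a : ↥(S1 L ((L : ℤ) • z) κ) → 𝔸), ‖a‖ < c3 d L / 2 →
    DifferentiableAt ℂ (fun a : ↥(S1 L ((L : ℤ) • z) κ) → 𝔸 =>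
      Ccov L (avgIter L U₀ j) (insCfg (S1 L ((L : ℤ) • z) κ) a) ((L : ℤ) • z) κ) a := by
  intro j hj z κ a ha
  have hL1 : 1 ≤ L := le_trans (by norm_num) hL
  obtain ⟨hV, -, -, -⟩ := level_data L hL hG k U₀ hU₀ hα hα3 hα4 h52 j hj.le
  obtain ⟨hreg, hα1⟩ := level_loops L hL hG k U₀ hU₀ hα hα3 hα4 h52 j hj.le ((L : ℤ) • z) κ
  refine (differentiableOn_Ccov_insCfg hL1 hV _ κ hα1 hreg _).differentiableAt (isOpen_ball.mem_nhds ?_)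
  rw [mem_ball_zero_iff]
  linarith [c3_pos d hL1]

end Regime

end Literature.MathematicalPhysics.QuantumFieldTheory.Balaban1983to89.B7Prop5GeneralLevels

end
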